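import Summits.MatrixMultiplication.MatrixMultiplication.Theorems.HiddenToeplitzCornersToeplitzLikeDetCostPairs

/-!
# Stub `stub_pairsSimulation` of crux `CondensationDistance.DerivationsBoundOmega`
# (stmt-MatrixMultiplication-15940), line `birth`

Strassen's numerator/denominator simulation (Vermeidung von Divisionen, pairs form; BCS 1997 §7.1)
for the leading minor of the generic matrix: if `det X` — `X` the leading `n × n` block of the
generic `n × m'` matrix `Z = [X | Y]`, viewed in `ℂ(Z) = Frac ℂ[Z]` — is derivable in `s` `Ω`-steps
(linear combinations, products, inverses of nonzero elements; constants of `ℂ` free: the cost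
predicate `Derivable` of `DivisionSLP.lean`, BCS Def. (4.7)) from the entries of `Z`, then some
NONZERO multiple `q · det X`, `q ∈ ℂ[Z]`, is computed by a division-free fan-in-two arithmetic
circuit of size `≤ 4 s` (`complexity`, `ArithCircuit.lean`).

Proof: this is the in-tree theorem
`Summit.MatrixMultiplication.MatrixMultiplication.Theorems.stub_pairs`
(`Theorems/HiddenToeplitzCornersToeplitzLikeDetCostPairs.lean`: a derivation of length `n` over
`K = Frac ℂ[X_σ]` from the images of the free inputs and of a division-free fan-in-two program `l`,
reaching the image of `f`, gives `q ≠ 0` with `complexity (q * f) ≤ |l| + 4 n`) with the empty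
program `l = []`, after enlarging the available set from the variables `Set.range (algebraMap ∘ X)`
to the image of all free inputs (`Derivable.mono`, `ArithCircuit.X_mem_freeInputs`).

Target tree file:
`Summits/MatrixMultiplication/MatrixMultiplication/Theorems/CondensationDistanceDerivationsBoundOmegaStubPairsSimulation.lean`
(helper for the crux, landed with `--supports stmt-MatrixMultiplication-15940`); the theorem keeps
EXACTLY the registered name and signature of the skeleton `Cruxes/DerivationsBoundOmega/Lines/birth.lean`.

## References
* V. Strassen, *Vermeidung von Divisionen*, J. reine angew. Math. 264 (1973) 184–202, §2.
* P. Bürgisser, M. Clausen, M. A. Shokrollahi, *Algebraic Complexity Theory*, Springer 1997, §7.1.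
-/

set_option linter.dupNamespace false

namespace Summit.MatrixMultiplication.MatrixMultiplication.Theorems.DerivationsBoundOmega

open Literature.Computability.AlgebraicComplexity

/-- **Strassen's numerator/denominator simulation (Vermeidung von Divisionen, pairs form)** for the
leading `n × n` minor `det X` of the generic `n × m'` matrix `Z`: a derivation of `det X` of length
`s` over `ℂ(Z)` from the entries of `Z` yields a nonzero `q ∈ ℂ[Z]` with
`complexity (q · det X) ≤ 4 s`. Registered stub `stub_pairsSimulation` of line `birth` of crux
`DerivationsBoundOmega`; an instance of the in-tree `Theorems.stub_pairs` with the empty program.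
[cite: Strassen1973, §2] -/
theorem stub_pairsSimulation :
    ∀ (n m' : ℕ) (h : n ≤ m') (s : ℕ),
      Derivable ℂ s
        (Set.range fun p : Fin n × Fin m' =>
          algebraMap (MvPolynomial (Fin n × Fin m') ℂ) (FractionRing (MvPolynomial (Fin n × Fin m') ℂ))
            (MvPolynomial.X p))
        {algebraMap (MvPolynomial (Fin n × Fin m') ℂ) (FractionRing (MvPolynomial (Fin n × Fin m') ℂ))
          (Matrix.det (Matrix.of fun i j : Fin n => MvPolynomial.X (i, Fin.castLE h j)))} →
      ∃ q : MvPolynomial (Fin n × Fin m') ℂ, q ≠ 0 ∧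
        complexity (q * Matrix.det (Matrix.of fun i j : Fin n => MvPolynomial.X (i, Fin.castLE h j))) ≤
          4 * s := by
  intro n m' h s hD
  -- enlarge the available set: the variables are among the (images of the) free inputs
  have hB' : Derivable ℂ s
      ((algebraMap (MvPolynomial (Fin n × Fin m') ℂ) (FractionRing (MvPolynomial (Fin n × Fin m') ℂ))) ''
        (ArithCircuit.freeInputs ℂ (Fin n × Fin m') ∪
          {x | x ∈ ([] : List (MvPolynomial (Fin n × Fin m') ℂ))}))
      {algebraMap (MvPolynomial (Fin n × Fin m') ℂ) (FractionRing (MvPolynomial (Fin n × Fin m') ℂ))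
        (Matrix.det (Matrix.of fun i j : Fin n => MvPolynomial.X (i, Fin.castLE h j)))} := by
    refine hD.mono le_rfl ?_ subset_rfl
    rintro _ ⟨p, rfl⟩
    exact ⟨_, Or.inl (ArithCircuit.X_mem_freeInputs p), rfl⟩
  -- Strassen's pairs simulation with the empty division-free program
  obtain ⟨q, hq, hc⟩ := stub_pairs [] (by simp) s _ hB' _ (Set.mem_singleton _)
  exact ⟨q, hq, by simpa using hc⟩

end Summit.MatrixMultiplication.MatrixMultiplication.Theorems.DerivationsBoundOmega
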